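import Mathlib
import Literature.Analysis.FluidPDE.SelfSimilarCollapseAnsatz
import HarnessLib

/-!
# Decorative binders of the self-similar stubs of the crux `EulerZoomLiouville.PowerGaugeEulerLiouville`:
# homogeneous `C⁰` profiles vanish; time-periodic / traveling self-similar fields have homogeneous profiles

Route №10 `EulerZoomLiouville` (NavierStokesRegularity), crux E = stmt-NavierStokesRegularity-19832,
registered open stubs `stub_selfSimilarC2Needle` (THE ONE STATEMENT) and `stub_selfSimilarWeakRest`
(skeleton `Cruxes/PowerGaugeEulerLiouville/Lines/birth.lean`, LEAD ns-typeII-p2).  Both stubs carry the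
binders `IsExtremalProfile ρ V`, `¬ IsHomogeneousProfile ρ V` and `¬ IsSymmetricWeak u H`; THE ONE
STATEMENT also carries `ContDiff ℝ 2 V`.  This file records, in the binders' VERBATIM unfolded shapes
(no import of the `Cruxes/` line file), two implications that make binders decorative
(RESIDUE-MEMO-19832-g10 §2):

* `Binders.eq_zero_of_homogeneous_of_continuousAt` — a critically homogeneous profile
  `V (s • y) = s^{−(1+ρ)} • V y` (`s > 0`; degree `−(1+ρ) < 0`) which is merely CONTINUOUS AT THE
  ORIGIN is identically zero (let `s → 0⁺` in `‖V (s • y)‖ = s^{−(1+ρ)} ‖V y‖`);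
  `Binders.not_homogeneous_of_contDiff_of_extremal` — hence `ContDiff ℝ 2 V → IsExtremalProfile ρ V →
  ¬ IsHomogeneousProfile ρ V` (the zero profile is not extremal): in THE ONE STATEMENT the binder
  `¬ IsHomogeneousProfile ρ V` is implied by the others;
* `Binders.homogeneous_of_selfSimilar_of_timePeriodic` — an EXACTLY SELF-SIMILAR field
  `u(τ) = (−τ)^{γ−1} V((−τ)^{−γ} ·)` (`γ = 1/(2+ρ)`, `τ < 0`) which is TIME-PERIODIC on the slab,
  `u(τ − P) = u(τ)` for `τ < 0` (`P > 0`), has a critically homogeneous profile: comparing the two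
  representations of `u(−a) = u(−a−P)` at `x = a^γ y` gives `V(s • y) = s^{−(1+ρ)} • V y` for the scale
  `s = (1 + P/a)^{−γ}`, and `a = P/(s^{−(2+ρ)} − 1)` realises every `s ∈ (0,1)` (then `s > 1` by
  inversion);
* `Binders.homogeneous_of_selfSimilar_of_travelingWave` — an exactly self-similar field which is a
  TRAVELING WAVE, `u(τ, y) = U(y − τ b)`, has a critically homogeneous profile: `V` has the affine
  self-maps `V(a^γ z + (a−1) b) = a^{γ−1} V(z)` (`a > 0`, `profile_affine_of_travelingWave`); composing
  the maps of parameters `a, c` and comparing with the one of parameter `ac` (same linear part) makes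
  `V` invariant under the translate by `(c−1)(a^γ−a) b` (`profile_translate_of_travelingWave`); these
  periods cover `(−∞, 2−2^γ)` hence all of `ℝ`, so the translation parts drop out and `a = s^{2+ρ}`
  gives homogeneity (no case distinction on `b`).
Hence (`…not_timePeriodic_…`, `…not_travelingWave_…`) the first two disjuncts of `IsSymmetricWeak u H`
are incompatible with `¬ IsHomogeneousProfile ρ V` for exactly self-similar members; the sequel
`…SelfSimilarBinderReductionsScrew` treats the screw disjunct (via the `A`-gauge) and assembles
`InClass → exactly self-similar → IsExtremalProfile → ¬ IsHomogeneousProfile → ¬ IsSymmetricWeak`.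

Pure algebra / topology: no class hypothesis, no profile equation.

WHAT THIS IS NOT: not NS, not E, not a stub — bookkeeping lemmas letting the LEAD drop binders from the
self-similar stubs; `--supports` stmt-19832. [folklore]
-/

noncomputable section

-- flat `Theorems/<Route><Decl>…` files of one crux share the namespace of the crux (tree convention)
set_option linter.dupNamespace false

open MeasureTheory Set Filter Topology Metric Function
open scoped ENNReal NNReal

namespace Summit.NavierStokesRegularity.NavierStokesRegularity.Theorems.PowerGaugeEulerLiouville

open Literature.Analysis Literature.Analysis.FluidPDE

namespace Binders

section Homogeneous

variable {V : EuclideanSpace ℝ (Fin 3) → EuclideanSpace ℝ (Fin 3)}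

/-- **A critically homogeneous profile continuous at the origin vanishes.**  If
`V (s • y) = s^{−(1+ρ)} • V y` for all `s > 0`, `y` (`1 + ρ > 0`) and `V` is continuous at `0`, then
`V = 0`: at `y = 0` the identity with `s = 2` forces `V 0 = 0`, and for `y` with `V y ≠ 0` the points
`(n+1)⁻¹ • y → 0` carry `‖V‖ = (n+1)^{1+ρ} ‖V y‖ ≥ ‖V y‖`, contradicting `V((n+1)⁻¹ • y) → V 0 = 0`.
[folklore] -/
theorem eq_zero_of_homogeneous_of_continuousAt {ρ : ℝ} (hρ : 0 < 1 + ρ)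
    (hhom : ∀ s : ℝ, 0 < s → ∀ y : EuclideanSpace ℝ (Fin 3), V (s • y) = s ^ (-(1 + ρ)) • V y)
    (hV : ContinuousAt V 0) : V = 0 := by
  -- `V 0 = 0`
  have h0 : V 0 = 0 := by
    have h := hhom 2 two_pos 0
    rw [smul_zero] at h
    have hlt : (2 : ℝ) ^ (-(1 + ρ)) < 1 :=
      Real.rpow_lt_one_of_one_lt_of_neg (by norm_num) (by linarith)
    have h' : (1 - (2 : ℝ) ^ (-(1 + ρ))) • V 0 = 0 := by
      rw [sub_smul, one_smul, ← h, sub_self]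
    rcases smul_eq_zero.1 h' with h1 | h1
    · exact absurd h1 (by linarith)
    · exact h1
  funext y
  by_contra hy
  have hpos : 0 < ‖V y‖ := norm_pos_iff.2 hy
  -- `V ((n+1)⁻¹ • y) → V 0 = 0`
  have hseq : Tendsto (fun n : ℕ => (1 / ((n : ℝ) + 1)) • y) atTop (𝓝 0) := by
    simpa using (tendsto_one_div_add_atTop_nhds_zero_nat (𝕜 := ℝ)).smul_const y
  have htend : Tendsto (fun n : ℕ => V ((1 / ((n : ℝ) + 1)) • y)) atTop (𝓝 0) := by
    have := hV.tendsto.comp hseq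
    rwa [h0] at this
  have hev := (htend.eventually (Metric.ball_mem_nhds (0 : EuclideanSpace ℝ (Fin 3)) hpos)).exists
  obtain ⟨n, hn'⟩ := hev
  have hn : ‖V ((1 / ((n : ℝ) + 1)) • y)‖ < ‖V y‖ := by
    simpa only [mem_ball, dist_zero_right] using hn'
  -- but `‖V ((n+1)⁻¹ • y)‖ = (n+1)^{1+ρ} ‖V y‖ ≥ ‖V y‖`
  have hn1 : (0 : ℝ) < (n : ℝ) + 1 := by positivity
  have hs : (0 : ℝ) < 1 / ((n : ℝ) + 1) := by positivity
  rw [hhom _ hs, norm_smul, Real.norm_of_nonneg (Real.rpow_nonneg hs.le _)] at hn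
  have hge : (1 : ℝ) ≤ (1 / ((n : ℝ) + 1)) ^ (-(1 + ρ)) := by
    rw [Real.rpow_neg hs.le, one_div, Real.inv_rpow hn1.le, inv_inv]
    exact Real.one_le_rpow (by linarith) hρ.le
  have : ‖V y‖ ≤ (1 / ((n : ℝ) + 1)) ^ (-(1 + ρ)) * ‖V y‖ := le_mul_of_one_le_left hpos.le hge
  linarith

/-- A critically homogeneous profile continuous at the origin is NOT extremal: its normalised ball
energies vanish (binder shapes of `IsHomogeneousProfile` / `IsExtremalProfile` verbatim). [folklore] -/
theorem not_extremal_of_homogeneous_of_continuousAt {ρ : ℝ} (hρ : 0 < 1 + ρ)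
    (hhom : ∀ s : ℝ, 0 < s → ∀ y : EuclideanSpace ℝ (Fin 3), V (s • y) = s ^ (-(1 + ρ)) • V y)
    (hV : ContinuousAt V 0) :
    ¬ (∃ ε : ℝ, 0 < ε ∧ ∃ L₀ : ℝ, ∀ L : ℝ, L₀ ≤ L →
      ε ≤ L ^ (2 * ρ - 1) * ∫ y in Metric.ball (0 : EuclideanSpace ℝ (Fin 3)) L, ‖V y‖ ^ 2) := by
  rintro ⟨ε, hε, L₀, hL⟩
  have hV0 := eq_zero_of_homogeneous_of_continuousAt hρ hhom hV
  have h := hL L₀ le_rfl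
  rw [hV0] at h
  simp only [Pi.zero_apply, norm_zero, ne_eq, OfNat.ofNat_ne_zero, not_false_eq_true, zero_pow,
    integral_zero, mul_zero] at h
  exact absurd h (not_le.2 hε)

/-- **The binder `¬ IsHomogeneousProfile ρ V` of THE ONE STATEMENT is decorative**: for a `C²`
velocity profile, `IsExtremalProfile ρ V → ¬ IsHomogeneousProfile ρ V` (shapes verbatim; any
`ρ > −1`, in particular the window `0 < ρ ≤ ½`). [folklore] -/
theorem not_homogeneous_of_contDiff_of_extremal {ρ : ℝ} (hρ : 0 < 1 + ρ) (hV : ContDiff ℝ 2 V)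
    (hext : ∃ ε : ℝ, 0 < ε ∧ ∃ L₀ : ℝ, ∀ L : ℝ, L₀ ≤ L →
      ε ≤ L ^ (2 * ρ - 1) * ∫ y in Metric.ball (0 : EuclideanSpace ℝ (Fin 3)) L, ‖V y‖ ^ 2) :
    ¬ (∀ s : ℝ, 0 < s → ∀ y : EuclideanSpace ℝ (Fin 3), V (s • y) = s ^ (-(1 + ρ)) • V y) :=
  fun hhom => not_extremal_of_homogeneous_of_continuousAt hρ hhom hV.continuous.continuousAt hext

/-- The same with mere continuity of the profile (the weak stub's use: a continuous extremal profile
is not critically homogeneous). [folklore] -/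
theorem not_homogeneous_of_continuous_of_extremal {ρ : ℝ} (hρ : 0 < 1 + ρ) (hV : Continuous V)
    (hext : ∃ ε : ℝ, 0 < ε ∧ ∃ L₀ : ℝ, ∀ L : ℝ, L₀ ≤ L →
      ε ≤ L ^ (2 * ρ - 1) * ∫ y in Metric.ball (0 : EuclideanSpace ℝ (Fin 3)) L, ‖V y‖ ^ 2) :
    ¬ (∀ s : ℝ, 0 < s → ∀ y : EuclideanSpace ℝ (Fin 3), V (s • y) = s ^ (-(1 + ρ)) • V y) :=
  fun hhom => not_extremal_of_homogeneous_of_continuousAt hρ hhom hV.continuousAt hext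

end Homogeneous

section TimePeriodic

variable {V : EuclideanSpace ℝ (Fin 3) → EuclideanSpace ℝ (Fin 3)}
  {u : ℝ → EuclideanSpace ℝ (Fin 3) → EuclideanSpace ℝ (Fin 3)}

/-- **One scale from one period.**  If `u(τ) = (−τ)^{γ−1} V((−τ)^{−γ}·)` for `τ < 0` and
`u(τ − P) = u(τ)` for `τ < 0`, then for every `a > 0`, comparing `u(−a−P) = u(−a)` at the point
`x = a^γ • y`: `V (((a+P)/a)^{−γ} • y) = ((a+P)/a)^{1−γ} • V y`. [folklore] -/
theorem profile_scale_of_timePeriodic {γ P : ℝ}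
    (hu : ∀ τ : ℝ, τ < 0 → u τ = selfSimilarCollapse γ 0 V τ)
    (hper : ∀ τ : ℝ, τ < 0 → u (τ - P) = u τ) (hP : 0 ≤ P) {a : ℝ} (ha : 0 < a)
    (y : EuclideanSpace ℝ (Fin 3)) :
    V (((a + P) / a) ^ (-γ) • y) = ((a + P) / a) ^ (1 - γ) • V y := by
  have haP : 0 < a + P := by linarith
  have h := congrFun (hper (-a) (by linarith)) ((a ^ γ) • y)
  rw [hu (-a) (by linarith), hu (-a - P) (by linarith), selfSimilarCollapse_apply,
    selfSimilarCollapse_apply, show (0 : ℝ) - (-a - P) = a + P by ring,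
    show (0 : ℝ) - -a = a by ring, smul_smul, smul_smul, ← Real.rpow_add ha, neg_add_cancel,
    Real.rpow_zero, one_smul] at h
  -- `(a+P)^{-γ} a^{γ} = ((a+P)/a)^{-γ}`
  have e1 : (a + P) ^ (-γ) * a ^ γ = ((a + P) / a) ^ (-γ) := by
    rw [Real.div_rpow haP.le ha.le, Real.rpow_neg ha.le, div_eq_mul_inv, inv_inv]
  rw [e1] at h
  -- solve `(a+P)^{γ-1} • V (s • y) = a^{γ-1} • V y`
  have hne : (a + P) ^ (γ - 1) ≠ 0 := (Real.rpow_pos_of_pos haP _).ne'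
  have h2 := congrArg (fun v => ((a + P) ^ (γ - 1))⁻¹ • v) h
  simp only [smul_smul, inv_mul_cancel₀ hne, one_smul] at h2
  rw [h2]
  congr 1
  rw [Real.div_rpow haP.le ha.le, show (1 : ℝ) - γ = -(γ - 1) by ring, Real.rpow_neg haP.le,
    Real.rpow_neg ha.le, div_eq_mul_inv, inv_inv]

/-- **Exactly self-similar + time-periodic ⇒ critically homogeneous profile.**  With the crux's
exponent `γ = 1/(2+ρ)` (`ρ > 0`): if `u(τ) = selfSimilarCollapse γ 0 V τ` for `τ < 0` and
`u(τ − P) = u(τ)` for `τ < 0` with `P > 0`, then `V (s • y) = s^{−(1+ρ)} • V y` for all `s > 0`, `y`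
(`IsExactlySelfSimilar`'s velocity clause + the time-periodic disjunct of `IsSymmetricWeak` ⇒
`IsHomogeneousProfile`, shapes verbatim).  Every `s ∈ (0,1)` is a one-period scale,
`s = (1 + P/a)^{−γ}` with `a = P/(s^{−(2+ρ)} − 1)`; `s > 1` by inversion. [folklore] -/
theorem homogeneous_of_selfSimilar_of_timePeriodic {ρ : ℝ} (hρ : 0 < ρ)
    (hu : ∀ τ : ℝ, τ < 0 → u τ = selfSimilarCollapse (1 / (2 + ρ)) 0 V τ)
    {P : ℝ} (hP : 0 < P) (hper : ∀ τ : ℝ, τ < 0 → u (τ - P) = u τ) :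
    ∀ s : ℝ, 0 < s → ∀ y : EuclideanSpace ℝ (Fin 3), V (s • y) = s ^ (-(1 + ρ)) • V y := by
  have h2ρ : (0 : ℝ) < 2 + ρ := by linarith
  set γ : ℝ := 1 / (2 + ρ) with hγ
  have hγ0 : 0 < γ := by positivity
  -- the case `0 < s < 1`
  have hlt : ∀ s : ℝ, 0 < s → s < 1 → ∀ y : EuclideanSpace ℝ (Fin 3),
      V (s • y) = s ^ (-(1 + ρ)) • V y := by
    intro s hs hs1 y
    -- `t = s^{-(2+ρ)} > 1`, `a = P/(t-1) > 0`, `(a+P)/a = t`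
    set t : ℝ := s ^ (-(2 + ρ)) with ht
    have ht1 : 1 < t := Real.one_lt_rpow_of_pos_of_lt_one_of_neg hs hs1 (by linarith)
    set a : ℝ := P / (t - 1) with ha
    have ha0 : 0 < a := div_pos hP (by linarith)
    have hquot : (a + P) / a = t := by
      rw [add_div, div_self ha0.ne', ha, div_div_eq_mul_div, mul_div_cancel_left₀ _ hP.ne']
      ring
    have key := profile_scale_of_timePeriodic hu hper hP.le ha0 y
    rw [hquot] at key
    -- `t^{-γ} = s`, `t^{1-γ} = s^{-(1+ρ)}`
    have e1 : t ^ (-γ) = s := by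
      rw [ht, ← Real.rpow_mul hs.le, hγ]
      rw [show -(2 + ρ) * -(1 / (2 + ρ)) = 1 by field_simp, Real.rpow_one]
    have e2 : t ^ (1 - γ) = s ^ (-(1 + ρ)) := by
      rw [ht, ← Real.rpow_mul hs.le, hγ]
      congr 1
      field_simp
      ring
    rwa [e1, e2] at key
  intro s hs y
  rcases lt_trichotomy s 1 with hs1 | rfl | hs1
  · exact hlt s hs hs1 y
  · rw [one_smul, Real.one_rpow, one_smul]
  · -- `s > 1`: apply the first case to `s⁻¹` at the point `s • y`
    have hsi : 0 < s⁻¹ := inv_pos.2 hs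
    have h := hlt s⁻¹ hsi (inv_lt_one_of_one_lt₀ hs1) (s • y)
    rw [smul_smul, inv_mul_cancel₀ hs.ne', one_smul, Real.inv_rpow hs.le] at h
    -- `V y = (s^{-(1+ρ)})⁻¹ • V (s • y)`
    have hne : s ^ (-(1 + ρ)) ≠ 0 := (Real.rpow_pos_of_pos hs _).ne'
    have h2 := congrArg (fun v => s ^ (-(1 + ρ)) • v) h
    simp only [smul_smul, mul_inv_cancel₀ hne, one_smul] at h2
    exact h2.symm

/-- **The time-periodic disjunct of `¬ IsSymmetricWeak` is decorative in the self-similar stubs**: an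
exactly self-similar member (`γ = 1/(2+ρ)`, `ρ > 0`) whose profile is NOT critically homogeneous is
not time-periodic on the slab (shapes verbatim). [folklore] -/
theorem not_timePeriodic_of_selfSimilar_of_not_homogeneous {ρ : ℝ} (hρ : 0 < ρ)
    (hu : ∀ τ : ℝ, τ < 0 → u τ = selfSimilarCollapse (1 / (2 + ρ)) 0 V τ)
    (hnh : ¬ ∀ s : ℝ, 0 < s → ∀ y : EuclideanSpace ℝ (Fin 3), V (s • y) = s ^ (-(1 + ρ)) • V y) :
    ¬ ∃ P : ℝ, 0 < P ∧ ∀ τ : ℝ, τ < 0 → u (τ - P) = u τ :=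
  fun ⟨_, hP, hper⟩ => hnh (homogeneous_of_selfSimilar_of_timePeriodic hρ hu hP hper)

end TimePeriodic

section TravelingWave

variable {V : EuclideanSpace ℝ (Fin 3) → EuclideanSpace ℝ (Fin 3)}
  {u : ℝ → EuclideanSpace ℝ (Fin 3) → EuclideanSpace ℝ (Fin 3)}

/-- **The affine self-maps of a self-similar traveling profile.**  If
`u(τ) = (−τ)^{γ−1} V((−τ)^{−γ}·)` for `τ < 0` and `u(τ, y) = U(y − τ b)` for all `τ, y`, then
`V (a^γ • z + (a − 1) • b) = a^{γ−1} • V z` for every `a > 0`, `z` (compare `u(−a)` at `x = a^γ z`,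
and use `U = V(· − b)` from `a = 1`). [folklore] -/
theorem profile_affine_of_travelingWave {γ : ℝ} {U : EuclideanSpace ℝ (Fin 3) → EuclideanSpace ℝ (Fin 3)}
    {b : EuclideanSpace ℝ (Fin 3)}
    (hu : ∀ τ : ℝ, τ < 0 → u τ = selfSimilarCollapse γ 0 V τ)
    (htrav : u = fun τ y => U (y - τ • b)) {a : ℝ} (ha : 0 < a) (z : EuclideanSpace ℝ (Fin 3)) :
    V (a ^ γ • z + (a - 1) • b) = a ^ (γ - 1) • V z := by
  -- `a^{γ-1} • V z = U (a^γ • z + a • b)` for every `a > 0`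
  have key : ∀ a : ℝ, 0 < a → ∀ z : EuclideanSpace ℝ (Fin 3),
      a ^ (γ - 1) • V z = U (a ^ γ • z + a • b) := by
    intro a ha z
    have h := congrFun (hu (-a) (by linarith)) (a ^ γ • z)
    rw [selfSimilarCollapse_apply, show (0 : ℝ) - -a = a by ring, smul_smul, ← Real.rpow_add ha,
      neg_add_cancel, Real.rpow_zero, one_smul] at h
    rw [← h, htrav]
    simp only [neg_smul, sub_neg_eq_add]
  -- `a = 1`: `V w = U (w + b)`, i.e. `U w = V (w - b)`
  have h1 : ∀ w : EuclideanSpace ℝ (Fin 3), U w = V (w - b) := by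
    intro w
    have h := key 1 one_pos (w - b)
    rw [Real.one_rpow, Real.one_rpow, one_smul, one_smul, one_smul, sub_add_cancel] at h
    exact h.symm
  rw [key a ha z, h1]
  congr 1
  rw [sub_smul, one_smul, add_sub_assoc]

/-- **Translation periods of a self-similar traveling profile.**  Under the hypotheses of
`profile_affine_of_travelingWave`, `V (w + ((c − 1)(a^γ − a)) • b) = V w` for all `a, c > 0` and all
`w` (compose the affine self-maps with parameters `a`, `c` and compare with the one of parameter
`ac`: same linear part, translations differing by `(c−1)(a^γ−a) b`). [folklore] -/
theorem profile_translate_of_travelingWave {γ : ℝ} {U : EuclideanSpace ℝ (Fin 3) → EuclideanSpace ℝ (Fin 3)}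
    {b : EuclideanSpace ℝ (Fin 3)}
    (hu : ∀ τ : ℝ, τ < 0 → u τ = selfSimilarCollapse γ 0 V τ)
    (htrav : u = fun τ y => U (y - τ • b)) {a c : ℝ} (ha : 0 < a) (hc : 0 < c)
    (w : EuclideanSpace ℝ (Fin 3)) :
    V (w + ((c - 1) * (a ^ γ - a)) • b) = V w := by
  have hac : 0 < a * c := mul_pos ha hc
  -- the point `z` with `(ac)^γ • z = w - (ac - 1) • b`
  set z : EuclideanSpace ℝ (Fin 3) := ((a * c) ^ γ)⁻¹ • (w - (a * c - 1) • b) with hz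
  have hacγ : (a * c) ^ γ ≠ 0 := (Real.rpow_pos_of_pos hac _).ne'
  have hw : (a * c) ^ γ • z + (a * c - 1) • b = w := by
    rw [hz, smul_smul, mul_inv_cancel₀ hacγ, one_smul, sub_add_cancel]
  -- once with parameter `ac`
  have h1 := profile_affine_of_travelingWave hu htrav hac z
  rw [hw] at h1
  -- twice: parameter `c`, then `a`
  have h2 := profile_affine_of_travelingWave hu htrav hc z
  have h3 := profile_affine_of_travelingWave hu htrav ha (c ^ γ • z + (c - 1) • b)
  have h4 : V (a ^ γ • (c ^ γ • z + (c - 1) • b) + (a - 1) • b) = V w := by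
    rw [h3, h2, smul_smul, ← Real.mul_rpow ha.le hc.le, ← h1]
  -- the two arguments differ by the translation
  have harg : a ^ γ • (c ^ γ • z + (c - 1) • b) + (a - 1) • b =
      w + ((c - 1) * (a ^ γ - a)) • b := by
    rw [← hw, Real.mul_rpow ha.le hc.le]
    simp only [smul_add, smul_smul, add_assoc, ← add_smul]
    congr 2
    ring
  rw [harg] at h4
  exact h4

/-- **Exactly self-similar + traveling wave ⇒ critically homogeneous profile.**  With the crux's
exponent `γ = 1/(2+ρ)` (`ρ > 0`): if `u(τ) = selfSimilarCollapse γ 0 V τ` for `τ < 0` and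
`u = fun τ y => U (y − τ • b)` (the traveling disjunct of `IsSymmetricWeak`, velocity clause), then
`V (s • y) = s^{−(1+ρ)} • V y` for all `s > 0`, `y`.  The periods `(c−1)(2^γ−2)`, `c > 0`, cover
`(−∞, 2 − 2^γ)`, hence (with their negatives) all of `ℝ`; so `V` is invariant under every translate
along `b`, the affine self-maps reduce to `V (a^γ • z) = a^{γ−1} • V z`, and `a = s^{2+ρ}`. [folklore] -/
theorem homogeneous_of_selfSimilar_of_travelingWave {ρ : ℝ} (hρ : 0 < ρ)
    (hu : ∀ τ : ℝ, τ < 0 → u τ = selfSimilarCollapse (1 / (2 + ρ)) 0 V τ)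
    {U : EuclideanSpace ℝ (Fin 3) → EuclideanSpace ℝ (Fin 3)} {b : EuclideanSpace ℝ (Fin 3)}
    (htrav : u = fun τ y => U (y - τ • b)) :
    ∀ s : ℝ, 0 < s → ∀ y : EuclideanSpace ℝ (Fin 3), V (s • y) = s ^ (-(1 + ρ)) • V y := by
  have h2ρ : (0 : ℝ) < 2 + ρ := by linarith
  set γ : ℝ := 1 / (2 + ρ) with hγ
  have hγ0 : 0 < γ := by positivity
  have hγ1 : γ < 1 := by rw [hγ, div_lt_one h2ρ]; linarith
  -- `δ = 2 - 2^γ > 0`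
  have h2γ : (2 : ℝ) ^ γ < 2 := by
    have h := Real.rpow_lt_rpow_of_exponent_lt (by norm_num : (1 : ℝ) < 2) hγ1
    rwa [Real.rpow_one] at h
  -- every `t < 2 - 2^γ` is a period
  have hsmall : ∀ t : ℝ, t < 2 - (2 : ℝ) ^ γ → ∀ w : EuclideanSpace ℝ (Fin 3), V (w + t • b) = V w := by
    intro t ht w
    set c : ℝ := 1 + t / ((2 : ℝ) ^ γ - 2) with hc
    have hneg : (2 : ℝ) ^ γ - 2 < 0 := by linarith
    have hc0 : 0 < c := by
      rw [hc]
      have : -1 < t / ((2 : ℝ) ^ γ - 2) := by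
        rw [lt_div_iff_of_neg hneg]; linarith
      linarith
    have h := profile_translate_of_travelingWave hu htrav (two_pos) hc0 w
    have ht' : (c - 1) * ((2 : ℝ) ^ γ - 2) = t := by
      rw [hc, add_sub_cancel_left, div_mul_cancel₀ _ hneg.ne]
    rwa [ht'] at h
  -- hence every `t` is a period
  have hall : ∀ t : ℝ, ∀ w : EuclideanSpace ℝ (Fin 3), V (w + t • b) = V w := by
    intro t w
    by_cases ht : t < 2 - (2 : ℝ) ^ γ
    · exact hsmall t ht w
    · have hnt : -t < 2 - (2 : ℝ) ^ γ := by linarith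
      have h := hsmall (-t) hnt (w + t • b)
      rw [add_assoc, ← add_smul, add_neg_cancel, zero_smul, add_zero] at h
      exact h.symm
  -- the affine self-maps without their translation part
  have hhom : ∀ a : ℝ, 0 < a → ∀ z : EuclideanSpace ℝ (Fin 3), V (a ^ γ • z) = a ^ (γ - 1) • V z := by
    intro a ha z
    rw [← profile_affine_of_travelingWave hu htrav ha z, hall]
  intro s hs y
  have h := hhom (s ^ (1 / γ)) (Real.rpow_pos_of_pos hs _) y
  rw [← Real.rpow_mul hs.le, ← Real.rpow_mul hs.le, show 1 / γ * γ = 1 by field_simp,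
    Real.rpow_one] at h
  rw [h]
  congr 1
  rw [hγ]
  congr 1
  field_simp
  ring

/-- **The traveling-wave disjunct of `¬ IsSymmetricWeak` is decorative in the self-similar stubs**
(shapes verbatim; the `H`-clause of the disjunct is not needed). [folklore] -/
theorem not_travelingWave_of_selfSimilar_of_not_homogeneous {ρ : ℝ} (hρ : 0 < ρ)
    {H : ℝ → EuclideanSpace ℝ (Fin 3) → EuclideanSpace ℝ (Fin 3) →L[ℝ] EuclideanSpace ℝ (Fin 3)}
    (hu : ∀ τ : ℝ, τ < 0 → u τ = selfSimilarCollapse (1 / (2 + ρ)) 0 V τ)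
    (hnh : ¬ ∀ s : ℝ, 0 < s → ∀ y : EuclideanSpace ℝ (Fin 3), V (s • y) = s ^ (-(1 + ρ)) • V y) :
    ¬ ∃ (U : EuclideanSpace ℝ (Fin 3) → EuclideanSpace ℝ (Fin 3))
        (G₀ : EuclideanSpace ℝ (Fin 3) → EuclideanSpace ℝ (Fin 3) →L[ℝ] EuclideanSpace ℝ (Fin 3))
        (b : EuclideanSpace ℝ (Fin 3)),
        u = (fun τ y => U (y - τ • b)) ∧ H = fun τ y => G₀ (y - τ • b) :=
  fun ⟨_, _, _, htrav, _⟩ => hnh (homogeneous_of_selfSimilar_of_travelingWave hρ hu htrav)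

end TravelingWave

end Binders

end Summit.NavierStokesRegularity.NavierStokesRegularity.Theorems.PowerGaugeEulerLiouville

end
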